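import Summits.ResolutionOfSingularities.ResolutionOfSingularities.Theorems.EquisingularLiftEquisingularLiftNatTowerVertex
import Summits.ResolutionOfSingularities.ResolutionOfSingularities.Theorems.EquisingularLiftEquisingularLiftNatD4Vertices
import Summits.ResolutionOfSingularities.ResolutionOfSingularities.Theorems.EquisingularLiftEquisingularLiftNatAffineOneStepOrigin
import Summits.ResolutionOfSingularities.ResolutionOfSingularities.Theorems.EquisingularLiftEquisingularLiftNatDepthTower
import HarnessLib

/-!
# [OURS] TOWER LEVELS `0` AND `1` FROM POLYNOMIAL DATA: one-step data ⟹ level `0` (affine origin and projective vertex); marked two-step data ⟹ level `1`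
# (the converter from the `hsec` clause of ✓ `twoStepAt_origin_marked` to the `hlev` payload of ✓ `towerLevel_succ_origin_marked`); the `D₄` vertex has level `1`
# (cruxes `Theses.EquisingularLift.EquisingularLiftNat` / `…NatThree` / `EquisingularLift`, stmt-ResolutionOfSingularities-20038 / -20148 / -15660)

[OURS · leafhand-res-equisingularlift-12 g0, 2026-08-31; cell `pub/decomp-res`] AI-produced, weaker than expert review; NOT a statement of any manuscript;
nothing here proves resolution of singularities in positive characteristic.  DEF-FREE helper; no `sorry`; standard axioms; ZERO named hypotheses.

These adapters let every vertex certificate of the depth programme be fed to ONE consumer, ✓ `isoHypPoint_of_towerVertices` (levels `0`, `1`, `2`, … mixed):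

* ★ `OneStep.towerLevel_zero_origin` — one-step data at the origin of `Spec K[y]/(Φ + Ψ)` ⟹ `D`-level `0` (✓ `oneStepAt_origin` + `hD0`);
* ★★ `OneStep.towerLevel_one_origin_marked` — MARKED two-step data (the `hsec` clause: translates with one-step data) ⟹ `D`-level `1` at the origin
  (✓ `towerLevel_succ_origin_marked` with `d = 0`, the payload produced by `towerLevel_zero_origin`);
* ★★ `towerLevel_zero_vertex` — one-step data at a vertex chart of a prime form ⟹ `D`-level `0` at the point of `V₊(F)` over the vertex
  (✓ `OneStep.isRegularLocalRing_stalk_of_isBlowup_comap`, ✓ `exists_vertexPoint`);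
* ★★ `towerLevel_one_vertex_marked` — marked two-step data at a vertex chart ⟹ `D`-level `1` at the vertex point (✓ `towerLevel_succ_vertex_marked`, `d = 0`);
* ★★ `towerLevel_one_vertex_D₄` — the `D₄` vertex `y₀² + (y₁³ + y₂³)` (`2, 3 ≠ 0`, `t³ + 1` split) has `D`-level `1`.

Honest label: closes no registered stub.

References: [Hartshorne1977, I Thm. 5.1, II Ex. 7.12]; [StacksProject, Tags 0804, 080E]; through the cited tree files.
-/

set_option linter.dupNamespace false -- mandated namespace `Summit.<Summit>.<Problem>` of this single-conjunct summit

noncomputable section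

open CategoryTheory CategoryTheory.Limits AlgebraicGeometry TopologicalSpace
open Literature.AlgebraicGeometry.Resolution Literature.AlgebraicGeometry.Motives
open AlgebraicGeometry.Scheme.IdealSheafData
open MvPolynomial HomogeneousLocalization
open Literature.AlgebraicGeometry.Motives.SmoothHypersurface Literature.AlgebraicGeometry.Motives.ProjectiveSpace
open Summit.ResolutionOfSingularities.ResolutionOfSingularities.Cruxes.EquisingularLift.StrataSplit

namespace Summit.ResolutionOfSingularities.ResolutionOfSingularities.Cruxes.EquisingularLiftNat.Sections

/-- ★ **ONE-STEP DATA ⟹ LEVEL `0` at the origin of `Spec K[y]/(Φ + Ψ)`**, for every blow-up tower. [OURS] [cite: StacksProject, Tag 080E] -/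
theorem OneStep.towerLevel_zero_origin (K : Type) [Field K] {N : ℕ} (D : ℕ → ∀ Γ : Scheme.{0}, Γ → Prop)
    (hD0 : ∀ (Γ : Scheme.{0}) (y : Γ), IsClosed (({y} : Set Γ)) →
      (D 0 Γ y ↔ ∀ (hy : IsClosed (({y} : Set Γ))) (Z : Scheme.{0}) (τ : Z ⟶ Γ), IsBlowup τ (vanishingIdeal ⟨{y}, hy⟩) →
        ∀ z : Z, τ z = y → IsRegularLocalRing (Z.presheaf.stalk z)))
    (hDsucc : ∀ (d : ℕ) (Γ : Scheme.{0}) (y : Γ), IsClosed (({y} : Set Γ)) →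
      (D (d + 1) Γ y ↔ ∀ (hy : IsClosed (({y} : Set Γ))) (Z : Scheme.{0}) (τ : Z ⟶ Γ), IsBlowup τ (vanishingIdeal ⟨{y}, hy⟩) →
        ∃ S' : Finset Z, (∀ z : Z, τ z = y → z ∉ S' → IsRegularLocalRing (Z.presheaf.stalk z)) ∧
          ∀ z ∈ S', τ z = y ∧ IsClosed (({z} : Set Z)) ∧ ∃ d' ≤ d, D d' Z z))
    (Φ Ψ : MvPolynomial (Fin (N + 1)) K) {μ : ℕ} (hμ : 1 ≤ μ) (hΦ : Φ.IsHomogeneous μ) (hΦ0 : Φ ≠ 0)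
    (hΨ : Ψ ∈ Ideal.span (Set.range (X : Fin (N + 1) → MvPolynomial (Fin (N + 1)) K)) ^ (μ + 1))
    (hone : ∀ a : Fin (N + 1), ∃ G : MvPolynomial (Fin (N + 1)) K,
      aeval (fun j => X a * Function.update (X : Fin (N + 1) → MvPolynomial (Fin (N + 1)) K) a 1 j) (Φ + Ψ) = X a ^ μ * G ∧
      ∀ P : Ideal (MvPolynomial (Fin (N + 1)) K), P.IsPrime → (X a : MvPolynomial (Fin (N + 1)) K) ∈ P → G ∈ P → ∃ j, pderiv j G ∉ P)
    (y₀ : Spec (CommRingCat.of (MvPolynomial (Fin (N + 1)) K ⧸ Ideal.span {Φ + Ψ})))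
    (hy₀ : y₀.asIdeal = Ideal.map (Ideal.Quotient.mk (Ideal.span {Φ + Ψ}))
      (Ideal.span (Set.range (X : Fin (N + 1) → MvPolynomial (Fin (N + 1)) K)))) :
    D 0 (Spec (CommRingCat.of (MvPolynomial (Fin (N + 1)) K ⧸ Ideal.span {Φ + Ψ}))) y₀ := by
  have _ := hDsucc
  have hy₀cl : IsClosed ({y₀} : Set (Spec (CommRingCat.of (MvPolynomial (Fin (N + 1)) K ⧸ Ideal.span {Φ + Ψ})))) :=
    (PrimeSpectrum.isClosed_singleton_iff_isMaximal y₀).mpr (hy₀ ▸ OneStep.isMaximal_map_mk_span_range_X K Φ Ψ hμ hΦ hΨ)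
  exact (hD0 _ y₀ hy₀cl).mpr (OneStep.oneStepAt_origin K Φ Ψ hμ hΦ hΦ0 hΨ hone y₀ hy₀)

/-- ★★ **MARKED TWO-STEP DATA ⟹ LEVEL `1` at the origin of `Spec K[y]/(Φ + Ψ)`**, for every blow-up tower: the `hsec` clause of ✓ `twoStepAt_origin_marked`
(translates with ONE-STEP data) is converted into the `hlev` payload (`d = 0`) of ✓ `towerLevel_succ_origin_marked` by `towerLevel_zero_origin`. [OURS]
[cite: StacksProject, Tags 0804, 080E] -/
theorem OneStep.towerLevel_one_origin_marked (K : Type) [Field K] {N : ℕ} (D : ℕ → ∀ Γ : Scheme.{0}, Γ → Prop)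
    (hD0 : ∀ (Γ : Scheme.{0}) (y : Γ), IsClosed (({y} : Set Γ)) →
      (D 0 Γ y ↔ ∀ (hy : IsClosed (({y} : Set Γ))) (Z : Scheme.{0}) (τ : Z ⟶ Γ), IsBlowup τ (vanishingIdeal ⟨{y}, hy⟩) →
        ∀ z : Z, τ z = y → IsRegularLocalRing (Z.presheaf.stalk z)))
    (hDsucc : ∀ (d : ℕ) (Γ : Scheme.{0}) (y : Γ), IsClosed (({y} : Set Γ)) →
      (D (d + 1) Γ y ↔ ∀ (hy : IsClosed (({y} : Set Γ))) (Z : Scheme.{0}) (τ : Z ⟶ Γ), IsBlowup τ (vanishingIdeal ⟨{y}, hy⟩) →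
        ∃ S' : Finset Z, (∀ z : Z, τ z = y → z ∉ S' → IsRegularLocalRing (Z.presheaf.stalk z)) ∧
          ∀ z ∈ S', τ z = y ∧ IsClosed (({z} : Set Z)) ∧ ∃ d' ≤ d, D d' Z z))
    (Φ Ψ : MvPolynomial (Fin (N + 1)) K) {μ : ℕ} (hμ : 1 ≤ μ) (hΦ : Φ.IsHomogeneous μ) (hΦ0 : Φ ≠ 0)
    (hΨ : Ψ ∈ Ideal.span (Set.range (X : Fin (N + 1) → MvPolynomial (Fin (N + 1)) K)) ^ (μ + 1))
    (G : Fin (N + 1) → MvPolynomial (Fin (N + 1)) K)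
    (hG : ∀ a, aeval (fun j => X a * Function.update (X : Fin (N + 1) → MvPolynomial (Fin (N + 1)) K) a 1 j) (Φ + Ψ) = X a ^ μ * G a)
    (Λ : Fin (N + 1) → Finset (Fin (N + 1) → K))
    (hjac : ∀ a, ∀ P : Ideal (MvPolynomial (Fin (N + 1)) K), P.IsPrime → (X a : MvPolynomial (Fin (N + 1)) K) ∈ P → G a ∈ P →
      (∃ j, pderiv j (G a) ∉ P) ∨ ∃ lam ∈ Λ a, ∀ i, (X i - C (lam i) : MvPolynomial (Fin (N + 1)) K) ∈ P)
    (hsec : ∀ a, ∀ lam ∈ Λ a, G a ∈ Ideal.span (Set.range fun i : Fin (N + 1) => (X i - C (lam i) : MvPolynomial (Fin (N + 1)) K)) →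
      ∃ (μ' : ℕ) (Φ' Ψ' : MvPolynomial (Fin (N + 1)) K), 1 ≤ μ' ∧ Φ'.IsHomogeneous μ' ∧ Φ' ≠ 0 ∧
        Ψ' ∈ Ideal.span (Set.range (X : Fin (N + 1) → MvPolynomial (Fin (N + 1)) K)) ^ (μ' + 1) ∧
        aeval (fun i => X i + C (lam i)) (G a) = Φ' + Ψ' ∧
        ∀ b : Fin (N + 1), ∃ G' : MvPolynomial (Fin (N + 1)) K,
          aeval (fun j => X b * Function.update (X : Fin (N + 1) → MvPolynomial (Fin (N + 1)) K) b 1 j) (Φ' + Ψ') = X b ^ μ' * G' ∧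
          ∀ P : Ideal (MvPolynomial (Fin (N + 1)) K), P.IsPrime → (X b : MvPolynomial (Fin (N + 1)) K) ∈ P → G' ∈ P → ∃ j, pderiv j G' ∉ P)
    (y₀ : Spec (CommRingCat.of (MvPolynomial (Fin (N + 1)) K ⧸ Ideal.span {Φ + Ψ})))
    (hy₀ : y₀.asIdeal = Ideal.map (Ideal.Quotient.mk (Ideal.span {Φ + Ψ}))
      (Ideal.span (Set.range (X : Fin (N + 1) → MvPolynomial (Fin (N + 1)) K)))) :
    D 1 (Spec (CommRingCat.of (MvPolynomial (Fin (N + 1)) K ⧸ Ideal.span {Φ + Ψ}))) y₀ := by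
  refine OneStep.towerLevel_succ_origin_marked K D hD0 hDsucc 0 Φ Ψ hμ hΦ hΦ0 hΨ G hG Λ hjac (fun a lam hlam hGa => ?_) y₀ hy₀
  obtain ⟨μ', Φ', Ψ', hμ', hΦ', hΦ'0, hΨ', hGeq, hone'⟩ := hsec a lam hlam hGa
  exact ⟨μ', Φ', Ψ', hμ', hΦ', hΨ', hGeq, fun y' hy' =>
    ⟨0, le_rfl, OneStep.towerLevel_zero_origin K D hD0 hDsucc Φ' Ψ' hμ' hΦ' hΦ'0 hΨ' hone' y' hy'⟩⟩

/-- ★★ **ONE-STEP DATA AT A VERTEX ⟹ LEVEL `0` AT THE VERTEX POINT** of `V₊(F)` (`F` a prime form), for every blow-up tower. [OURS]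
[cite: Hartshorne1977, I Thm. 5.1, II Ex. 7.12] [cite: StacksProject, Tag 080E] -/
theorem towerLevel_zero_vertex (K : Type) [Field K] {m : ℕ} (D : ℕ → ∀ Γ : Scheme.{0}, Γ → Prop)
    (hD0 : ∀ (Γ : Scheme.{0}) (y : Γ), IsClosed (({y} : Set Γ)) →
      (D 0 Γ y ↔ ∀ (hy : IsClosed (({y} : Set Γ))) (Z : Scheme.{0}) (τ : Z ⟶ Γ), IsBlowup τ (vanishingIdeal ⟨{y}, hy⟩) →
        ∀ z : Z, τ z = y → IsRegularLocalRing (Z.presheaf.stalk z)))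
    (hDsucc : ∀ (d : ℕ) (Γ : Scheme.{0}) (y : Γ), IsClosed (({y} : Set Γ)) →
      (D (d + 1) Γ y ↔ ∀ (hy : IsClosed (({y} : Set Γ))) (Z : Scheme.{0}) (τ : Z ⟶ Γ), IsBlowup τ (vanishingIdeal ⟨{y}, hy⟩) →
        ∃ S' : Finset Z, (∀ z : Z, τ z = y → z ∉ S' → IsRegularLocalRing (Z.presheaf.stalk z)) ∧
          ∀ z ∈ S', τ z = y ∧ IsClosed (({z} : Set Z)) ∧ ∃ d' ≤ d, D d' Z z))
    (F : MvPolynomial (Fin (m + 2 + 1)) K) {d : ℕ} (hF : F.IsHomogeneous d) (hFp : Prime F) (c : Fin (m + 2 + 1))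
    (Φ Ψ : MvPolynomial (Fin (m + 2)) K) {μ : ℕ} (hμ : 1 ≤ μ) (hΦ : Φ.IsHomogeneous μ) (hΦ0 : Φ ≠ 0)
    (hΨ : Ψ ∈ Ideal.span (Set.range (X : Fin (m + 2) → MvPolynomial (Fin (m + 2)) K)) ^ (μ + 1))
    (hdeh : ProjectiveSpace.dehomogenize K c F = Φ + Ψ)
    (hone : ∀ l : Fin (m + 2), ∃ G : MvPolynomial (Fin (m + 2)) K,
      aeval (fun j => X l * Function.update (X : Fin (m + 2) → MvPolynomial (Fin (m + 2)) K) l 1 j) (Φ + Ψ) = X l ^ μ * G ∧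
      ∀ P : Ideal (MvPolynomial (Fin (m + 2)) K), P.IsPrime → (X l : MvPolynomial (Fin (m + 2)) K) ∈ P → G ∈ P → ∃ j, pderiv j G ∉ P) :
    letI := MvPolynomial.gradedAlgebra (σ := Fin (m + 2 + 1)) (R := K)
    ∃ (x₀ : ↥(hypersurface F).left) (_ : IsClosed ({x₀} : Set ↥(hypersurface F).left)),
      (∀ a : Fin (m + 2 + 1), a ≠ c → (X a : MvPolynomial (Fin (m + 2 + 1)) K) ∈ ((hypersurfaceι F).left x₀).asHomogeneousIdeal) ∧
      D 0 (hypersurface F).left x₀ := by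
  have _ := hDsucc
  letI := MvPolynomial.gradedAlgebra (σ := Fin (m + 2 + 1)) (R := K)
  letI := MvPolynomial.gradedAlgebra (σ := Fin (0 + 1)) (R := K)
  classical
  have he : Function.Injective (fun _ : Fin 1 => c) := Function.injective_of_subsingleton _
  have hec : ∀ j : Fin 1, (fun _ : Fin 1 => c) j = c := fun _ => rfl
  obtain ⟨fk, hfk', hfkC, hfke, hfk0⟩ := LinearCentre.exists_kill (R := K) (fun _ : Fin 1 => c) he
  have hfke' : ∀ j : Fin 1, fk (X c) = X j := fun j => hfke j
  have hfk0' : ∀ i : Fin (m + 2 + 1), i ≠ c → fk (X i) = 0 := fun i hi => hfk0 i (fun ⟨_, hj⟩ => hi hj.symm)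
  obtain ⟨x₀, hx₀cl, hx₀cl', hsupp, hx₀X, hΛ, hcomap⟩ :=
    exists_vertexPoint K F hF c ⟨μ, Φ, Ψ, hμ, hΦ, hΨ, hdeh⟩ fk hfk' hfkC hfke' hfk0'
  refine ⟨x₀, hx₀cl', hx₀X, (hD0 _ x₀ hx₀cl').mpr fun hx Z τ hτ z hz => ?_⟩
  have hτ' : IsBlowup τ (((Proj.map fk hfk').ker).comap (hypersurfaceι F).left) := by rw [hcomap]; exact hτ
  refine OneStep.isRegularLocalRing_stalk_of_isBlowup_comap K F c hF hFp hec fk hfk' hfkC hfke hfk0 Φ Ψ hΦ hμ hΦ0 hΨ hdeh hone hτ' z ?_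
  have hgoal : (hypersurfaceι F).left (τ z) ∈ ((Proj.map fk hfk').ker.support : Set (Proj (homogeneousSubmodule (Fin (m + 2 + 1)) K))) := by
    rw [hz, hsupp]; rfl
  rw [Scheme.IdealSheafData.support_comap]
  exact hgoal

/-- ★★ **MARKED TWO-STEP DATA AT A VERTEX ⟹ LEVEL `1` AT THE VERTEX POINT** (`d = 0` case of ✓ `towerLevel_succ_vertex_marked`, payload by
`OneStep.towerLevel_zero_origin`). [OURS] [cite: Hartshorne1977, II Prop. 5.9] [cite: StacksProject, Tag 0804] -/
theorem towerLevel_one_vertex_marked (K : Type) [Field K] {m : ℕ} (D : ℕ → ∀ Γ : Scheme.{0}, Γ → Prop)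
    (hD0 : ∀ (Γ : Scheme.{0}) (y : Γ), IsClosed (({y} : Set Γ)) →
      (D 0 Γ y ↔ ∀ (hy : IsClosed (({y} : Set Γ))) (Z : Scheme.{0}) (τ : Z ⟶ Γ), IsBlowup τ (vanishingIdeal ⟨{y}, hy⟩) →
        ∀ z : Z, τ z = y → IsRegularLocalRing (Z.presheaf.stalk z)))
    (hDsucc : ∀ (d : ℕ) (Γ : Scheme.{0}) (y : Γ), IsClosed (({y} : Set Γ)) →
      (D (d + 1) Γ y ↔ ∀ (hy : IsClosed (({y} : Set Γ))) (Z : Scheme.{0}) (τ : Z ⟶ Γ), IsBlowup τ (vanishingIdeal ⟨{y}, hy⟩) →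
        ∃ S' : Finset Z, (∀ z : Z, τ z = y → z ∉ S' → IsRegularLocalRing (Z.presheaf.stalk z)) ∧
          ∀ z ∈ S', τ z = y ∧ IsClosed (({z} : Set Z)) ∧ ∃ d' ≤ d, D d' Z z))
    (F : MvPolynomial (Fin (m + 2 + 1)) K) {d₀ : ℕ} (hF : F.IsHomogeneous d₀) (hd : 0 < d₀)
    (c : Fin (m + 2 + 1)) (Φ Ψ : MvPolynomial (Fin (m + 2)) K) {μ : ℕ} (hμ : 1 ≤ μ) (hΦ : Φ.IsHomogeneous μ) (hΦ0 : Φ ≠ 0)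
    (hΨ : Ψ ∈ Ideal.span (Set.range (X : Fin (m + 2) → MvPolynomial (Fin (m + 2)) K)) ^ (μ + 1))
    (hdeh : ProjectiveSpace.dehomogenize K c F = Φ + Ψ) (hrad : (Ideal.span {Φ + Ψ}).radical = Ideal.span {Φ + Ψ})
    (G : Fin (m + 2) → MvPolynomial (Fin (m + 2)) K)
    (hG : ∀ a, aeval (fun j => X a * Function.update (X : Fin (m + 2) → MvPolynomial (Fin (m + 2)) K) a 1 j) (Φ + Ψ) = X a ^ μ * G a)
    (Marks : Fin (m + 2) → Finset (Fin (m + 2) → K))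
    (hjac : ∀ a, ∀ P : Ideal (MvPolynomial (Fin (m + 2)) K), P.IsPrime → (X a : MvPolynomial (Fin (m + 2)) K) ∈ P → G a ∈ P →
      (∃ j, pderiv j (G a) ∉ P) ∨ ∃ lam ∈ Marks a, ∀ i, (X i - C (lam i) : MvPolynomial (Fin (m + 2)) K) ∈ P)
    (hsec : ∀ a, ∀ lam ∈ Marks a, G a ∈ Ideal.span (Set.range fun i : Fin (m + 2) => (X i - C (lam i) : MvPolynomial (Fin (m + 2)) K)) →
      ∃ (μ' : ℕ) (Φ' Ψ' : MvPolynomial (Fin (m + 2)) K), 1 ≤ μ' ∧ Φ'.IsHomogeneous μ' ∧ Φ' ≠ 0 ∧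
        Ψ' ∈ Ideal.span (Set.range (X : Fin (m + 2) → MvPolynomial (Fin (m + 2)) K)) ^ (μ' + 1) ∧
        aeval (fun i => X i + C (lam i)) (G a) = Φ' + Ψ' ∧
        ∀ b : Fin (m + 2), ∃ G' : MvPolynomial (Fin (m + 2)) K,
          aeval (fun j => X b * Function.update (X : Fin (m + 2) → MvPolynomial (Fin (m + 2)) K) b 1 j) (Φ' + Ψ') = X b ^ μ' * G' ∧
          ∀ P : Ideal (MvPolynomial (Fin (m + 2)) K), P.IsPrime → (X b : MvPolynomial (Fin (m + 2)) K) ∈ P → G' ∈ P → ∃ j, pderiv j G' ∉ P) :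
    letI := MvPolynomial.gradedAlgebra (σ := Fin (m + 2 + 1)) (R := K)
    ∃ (x₀ : ↥(hypersurface F).left) (_ : IsClosed ({x₀} : Set ↥(hypersurface F).left)),
      (∀ a : Fin (m + 2 + 1), a ≠ c → (X a : MvPolynomial (Fin (m + 2 + 1)) K) ∈ ((hypersurfaceι F).left x₀).asHomogeneousIdeal) ∧
      D 1 (hypersurface F).left x₀ := by
  refine towerLevel_succ_vertex_marked K D hD0 hDsucc 0 F hF hd c Φ Ψ hμ hΦ hΦ0 hΨ hdeh hrad G hG Marks hjac (fun a lam hlam hGa => ?_)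
  obtain ⟨μ', Φ', Ψ', hμ', hΦ', hΦ'0, hΨ', hGeq, hone'⟩ := hsec a lam hlam hGa
  exact ⟨μ', Φ', Ψ', hμ', hΦ', hΨ', hGeq, fun y' hy' =>
    ⟨0, le_rfl, OneStep.towerLevel_zero_origin K D hD0 hDsucc Φ' Ψ' hμ' hΦ' hΦ'0 hΨ' hone' y' hy'⟩⟩

/-- ★★ **THE `D₄` VERTEX `y₀² + (y₁³ + y₂³)` HAS LEVEL `1`** (`2, 3 ≠ 0` in `K`, `t³ + 1` split), for every blow-up tower. [OURS] [cite: Hartshorne1977, I Thm. 5.1, I Ex. 5.6] -/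
theorem towerLevel_one_vertex_D₄ (K : Type) [Field K] (D : ℕ → ∀ Γ : Scheme.{0}, Γ → Prop)
    (hD0 : ∀ (Γ : Scheme.{0}) (y : Γ), IsClosed (({y} : Set Γ)) →
      (D 0 Γ y ↔ ∀ (hy : IsClosed (({y} : Set Γ))) (Z : Scheme.{0}) (τ : Z ⟶ Γ), IsBlowup τ (vanishingIdeal ⟨{y}, hy⟩) →
        ∀ z : Z, τ z = y → IsRegularLocalRing (Z.presheaf.stalk z)))
    (hDsucc : ∀ (d : ℕ) (Γ : Scheme.{0}) (y : Γ), IsClosed (({y} : Set Γ)) →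
      (D (d + 1) Γ y ↔ ∀ (hy : IsClosed (({y} : Set Γ))) (Z : Scheme.{0}) (τ : Z ⟶ Γ), IsBlowup τ (vanishingIdeal ⟨{y}, hy⟩) →
        ∃ S' : Finset Z, (∀ z : Z, τ z = y → z ∉ S' → IsRegularLocalRing (Z.presheaf.stalk z)) ∧
          ∀ z ∈ S', τ z = y ∧ IsClosed (({z} : Set Z)) ∧ ∃ d' ≤ d, D d' Z z))
    (F : MvPolynomial (Fin (1 + 2 + 1)) K) {d : ℕ} (hF : F.IsHomogeneous d) (hd : 0 < d) (c : Fin (1 + 2 + 1))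
    (h2 : (2 : K) ≠ 0) (h3 : (3 : K) ≠ 0) (ζ : Fin 3 → K) (hζ : ∀ k, ζ k ^ 3 = -1)
    (hfac : ∀ i : Fin 3, ((X i - C (ζ 0)) * (X i - C (ζ 1)) * (X i - C (ζ 2)) : MvPolynomial (Fin 3) K) = X i ^ 3 + 1)
    (hdeh : ProjectiveSpace.dehomogenize K c F = X 0 ^ 2 + (X 1 ^ 3 + X 2 ^ 3))
    (hrad : (Ideal.span {(X 0 ^ 2 + (X 1 ^ 3 + X 2 ^ 3) : MvPolynomial (Fin 3) K)}).radical =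
      Ideal.span {(X 0 ^ 2 + (X 1 ^ 3 + X 2 ^ 3) : MvPolynomial (Fin 3) K)}) :
    letI := MvPolynomial.gradedAlgebra (σ := Fin (1 + 2 + 1)) (R := K)
    ∃ (x₀ : ↥(hypersurface F).left) (_ : IsClosed ({x₀} : Set ↥(hypersurface F).left)),
      (∀ a : Fin (1 + 2 + 1), a ≠ c → (X a : MvPolynomial (Fin (1 + 2 + 1)) K) ∈ ((hypersurfaceι F).left x₀).asHomogeneousIdeal) ∧
      D 1 (hypersurface F).left x₀ := by
  obtain ⟨hΨ, G, Λ, hG, hjac, hsec⟩ := SecondOrderPoint.twoStepData_D₄_marked' K h2 h3 ζ hζ hfac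
  have hΦ : (X 0 ^ 2 : MvPolynomial (Fin 3) K).IsHomogeneous 2 := isHomogeneous_X_pow (0 : Fin 3) 2
  have hΦ0 : (X 0 ^ 2 : MvPolynomial (Fin 3) K) ≠ 0 := pow_ne_zero 2 (X_ne_zero (0 : Fin 3))
  exact towerLevel_one_vertex_marked K D hD0 hDsucc F hF hd c (X 0 ^ 2) _ (by norm_num) hΦ hΦ0 hΨ hdeh hrad G hG Λ hjac hsec

end Summit.ResolutionOfSingularities.ResolutionOfSingularities.Cruxes.EquisingularLiftNat.Sections

end
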